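import Mathlib
import Literature.NumberTheory.EllipticCurves.IwasawaAlgebra

/-!
# STUB-IDEAS k2 (gen 17) — `stub_heegnerIndexLowerAtTwo`: **R106 by split reflection mod 2**

Typed sketch for the idea card `Ideas/stub_heegnerIndexLowerAtTwo-k2.md` (crux
`SplitBadTwoLowerHalfOfFacts`, stmt-BirchSwinnertonDyer-27851, route PrintCf2).

R106 (STUB-PLAN v3.7, OPEN typer row; load-bearing via `hε₀ : ε₀ = 0` in the critic's
`StubPlanT3ArmMSecondV12.armM_v12_of_T1minus`, see `eps0_loadBearing`) asks for `μ = 0` of the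
CROSSED Iwasawa module `Y = X^{(𝔭̄)}(F_∞)`, `F_∞ = F₀·K^{(𝔭)}_∞`, `K₀ = ℚ(√−7)`, `2 = 𝔭𝔭̄`.
The card proves it on paper by a LITERATURE TRANSFER (Wiles–Greenberg mod-2 Selmer/dual-Selmer
count + Kummer theory + Müller 2020 Thm 3.21) and types here:

* §A  the finite-level signature of `μ ≥ 1` in characteristic `2` (genuine Mathlib lemmas):
      `ω_n = (1+T)^{2^n} − 1 = T^{2^n}` in `𝔽₂[T]` and `dim 𝔽₂[T]/(ω_n) = 2^n` (unbounded);
* §B  the typed DICTIONARY of the reflection argument as an `ℕ`-shadow (dimension sequences along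
      the `𝔭`-tower) with the four print laws as named hypotheses, and the PROVED glue
      `dim Y/(2,ω_n)Y ≤ 2·[F₀:K₀] + B₀ + 1` ⇒ no `μ ≥ 1` signature;
* §C  R106's conclusion typed over the tree's `IwasawaAlgebra 2` / `muInvariant`
      (`Literature.NumberTheory.EllipticCurves.*`), with the two algebra helpers as declared stubs;
* §D  what the stub's arm M″ consumes: `ε₀ = 0` in the anchor identity, and the corollary
      `μ(G|_ℓ) = μ(Ē_∞/C̄_∞)`.

Nothing here proves BSD, the crux, or the stub; sorries occur only in the two declared helper
stubs `stub_fg_over_Zp_of_finite_mod_p`, `stub_isTorsion_of_fg_over_Zp`.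
-/

namespace Summit.BirchSwinnertonDyer.BirchSwinnertonDyer.Cruxes.SplitBadTwoLowerHalfOfFacts.HeegnerIndexTwo.K2G17

open Polynomial

/-! ## §A  The `μ ≥ 1` signature in characteristic 2 -/

/-- In `𝔽₂[T]`, `ω_n = (1+T)^{2^n} − 1 = T^{2^n}` (Frobenius). -/
theorem omega_eq_X_pow (n : ℕ) :
    ((1 + X : (ZMod 2)[X]) ^ 2 ^ n) - 1 = X ^ 2 ^ n := by
  rw [add_pow_char_pow, one_pow, add_sub_cancel_left]

/-- Hence `dim_{𝔽₂} 𝔽₂[T]/(ω_n) = 2^n`: a copy of `Λ/2 = 𝔽₂⟦T⟧` inside `Y/2Y` (i.e. `μ(Y) ≥ 1`)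
forces `dim Y/(2,ω_n)Y ≥ 2^n − O(1)`, unbounded in `n`. -/
theorem finrank_quot_omega (n : ℕ) :
    Module.finrank (ZMod 2) ((ZMod 2)[X] ⧸ Ideal.span {((1 + X : (ZMod 2)[X]) ^ 2 ^ n) - 1}) =
      2 ^ n := by
  rw [omega_eq_X_pow, finrank_quotient_span_eq_natDegree, natDegree_X_pow]

/-! ## §B  The split-reflection dictionary (ℕ-shadow along the `𝔭`-tower `F_n = F₀·K^{(𝔭)}_n`)

`dSelBar n = dim_{𝔽₂} X^{(𝔭̄)}(F_n)/2 = dim Sel^{(𝔭̄)}(F_n, ℤ/2)` (quadratic extensions of `F_n`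
unramified outside `𝔭̄`); `dT n = dim T^{𝔭̄}(F_n)`, `T^{𝔭̄}(F) = {x ∈ F^×/2 : (x) = 𝔞², x ∈ F_w^{×2}
∀ w ∣ 𝔭̄}` (the dual Selmer group `H¹_{L*}(F, μ₂)`); `dXp n = dim X^{(𝔭)}(F_n)/2` (the TOWER-prime
module at finite level); `gBar n`, `gP n` = number of places of `F_n` above `𝔭̄`, `𝔭`;
`dY n = dim_{𝔽₂} Y/(2, ω_n)Y` for the crossed module `Y = X^{(𝔭̄)}(F_∞)`. -/

/-- Dimension data along the `𝔭`-tower. -/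
structure SplitTowerDims where
  /-- `dim_{𝔽₂} X^{(𝔭̄)}(F_n) ⊗ 𝔽₂` -/
  dSelBar : ℕ → ℕ
  /-- `dim_{𝔽₂} T^{𝔭̄}(F_n)` (dual Selmer) -/
  dT : ℕ → ℕ
  /-- `dim_{𝔽₂} X^{(𝔭)}(F_n) ⊗ 𝔽₂` (tower-prime module, finite level) -/
  dXp : ℕ → ℕ
  /-- number of places of `F_n` above `𝔭̄` -/
  gBar : ℕ → ℕ
  /-- number of places of `F_n` above `𝔭` -/
  gP : ℕ → ℕ
  /-- `dim_{𝔽₂} Y/(2, ω_n) Y`, `Y = X^{(𝔭̄)}(F_∞)` the CROSSED module -/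
  dY : ℕ → ℕ

variable (D : SplitTowerDims)

/-- (A) **Wiles–Greenberg count mod 2, split case** [Washington, "Galois cohomology", Thm 2 in
Cornell–Silverman–Stevens 1997, pp. 166–167 (= DDT Thm 2.19), number-field form NSW (8.7.9)] with
`M = ℤ/2 = μ₂` (self-dual), `L_w = H¹` at `w ∣ 𝔭̄`, `L_w = H¹_ur` at `w ∣ 𝔭` and odd `w`, `0` at the
(complex) archimedean places: `#H¹_L/#H¹_{L*} = ∏_{w∣𝔭̄} 2^{1+n_w} · ∏_{w∣𝔭} 1 · ∏_{v∣∞} 2^{-1}`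
and `∑_{w∣𝔭̄} n_w = [F_n:ℚ_2-degrees above 𝔭̄] = [F_n:K₀] = r₂(F_n)` BECAUSE `𝔭̄` HAS DEGREE ONE
(splitness of `2` in `K₀` is used exactly here), whence `dim Sel^{(𝔭̄)} − dim T^{𝔭̄} = g_𝔭̄`. -/
def WilesCountModTwo : Prop := ∀ n, D.dSelBar n = D.gBar n + D.dT n

/-- (B) **Kummer inclusion** `T^{𝔭̄}(F) ↪ Hom(X^{(𝔭)}(F), ℤ/2)`: for `x ∈ T^{𝔭̄}(F)` the extension
`F(√x)/F` is unramified at every odd place (`(x) = 𝔞²`), split at `w ∣ 𝔭̄` (`x ∈ F_w^{×2}`), and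
arbitrary at `w ∣ 𝔭` — so it lies in the maximal abelian pro-2 extension unramified outside `𝔭`. -/
def KummerIntoTower : Prop := ∀ n, D.dT n ≤ D.dXp n

/-- (C) **Müller 2020, Thm 3.21 / Cor 3.22** (arXiv:2002.05647 p. 13; proved in Crişan–Müller,
Oukhaba–Viguié 2016, Choi–Kezuka–Li 2018): for `K` imaginary quadratic with `2 = 𝔭𝔭̄` split and
`F₀/K` finite abelian, `X^{(𝔭)}(F₀K^{(𝔭)}_∞)` is a finitely generated `ℤ₂`-module (say `B₀`
generators); hence `dim X^{(𝔭)}(F_n)/2 ≤ B₀ + 1` for every layer (the `+1` is `Gal(F_∞/F_n) ≅ ℤ₂`). -/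
def TowerPrimeFG (B : ℕ) : Prop := ∀ n, D.dXp n ≤ B

/-- (D) **finite decomposition**: `𝔭̄` is totally inert in `K^{(𝔭)}_∞/K₀` (`Frob_𝔭̄ ↦ π̄₀ = (1−√−7)/2
≡ 3 (mod 8)` topologically generates `ℤ₂^×/{±1}`), and `𝔭` is totally ramified from some layer
`n₀` on; so `g_𝔭̄(F_n), g_𝔭(F_n) ≤ [F₀:K₀] =: G` for all `n ≥ n₀`. -/
def DecompositionBounded (G n₀ : ℕ) : Prop := ∀ n ≥ n₀, D.gBar n ≤ G ∧ D.gP n ≤ G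

/-- (E) **inertia control** `Y_{Γ_n} ↠ X^{(𝔭̄)}(F_n)` (`n ≥ n₀`) with kernel generated by the
images of the inertia groups at the `g_𝔭(F_n)` places above `𝔭`, each pro-cyclic (it injects into
`Γ_n ≅ ℤ₂`): `dim Y/(2,ω_n) ≤ dim X^{(𝔭̄)}(F_n)/2 + g_𝔭(F_n)`. -/
def InertiaControl (n₀ : ℕ) : Prop := ∀ n ≥ n₀, D.dY n ≤ D.dSelBar n + D.gP n

/-- The **split mod-2 reflection inequality** (A)+(B): for every layer,
`dim X^{(𝔭̄)}(F_n)/2 ≤ g_𝔭̄(F_n) + dim X^{(𝔭)}(F_n)/2`. -/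
theorem splitReflection_le (hA : WilesCountModTwo D) (hB : KummerIntoTower D) :
    ∀ n, D.dSelBar n ≤ D.gBar n + D.dXp n := by
  intro n
  have h1 := hA n
  have h2 := hB n
  omega

/-- **R106, finite-level form**: `dim_{𝔽₂} Y/(2,ω_n)Y ≤ 2·[F₀:K₀] + B₀ + 1`, uniformly in
`n ≥ n₀`.  (Then `Y/2Y = lim Y/(2,ω_n)Y` is finite and compact Nakayama gives `Y` f.g. over `ℤ₂`,
§C.) -/
theorem crossed_dim_bounded {B G n₀ : ℕ} (hA : WilesCountModTwo D) (hB : KummerIntoTower D)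
    (hC : TowerPrimeFG D B) (hD : DecompositionBounded D G n₀) (hE : InertiaControl D n₀) :
    ∀ n ≥ n₀, D.dY n ≤ 2 * G + B := by
  intro n hn
  have h1 := splitReflection_le D hA hB n
  have h2 := hC n
  have h3 := hD n hn
  have h4 := hE n hn
  omega

/-- What `μ(Y) ≥ 1` would force at finite level (§A): `dim Y/(2,ω_n)Y ≥ 2^n − c`. -/
def MuPositiveSignature (dY : ℕ → ℕ) : Prop := ∃ c : ℕ, ∀ n, 2 ^ n ≤ dY n + c

/-- A uniformly bounded `dim Y/(2,ω_n)Y` is incompatible with the `μ ≥ 1` signature. -/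
theorem not_muPositive_of_bounded {dY : ℕ → ℕ} {C n₀ : ℕ} (h : ∀ n ≥ n₀, dY n ≤ C) :
    ¬ MuPositiveSignature dY := by
  rintro ⟨c, hc⟩
  have h1 := hc (n₀ + C + c + 1)
  have h2 := h (n₀ + C + c + 1) (by omega)
  have h3 : n₀ + C + c + 1 < 2 ^ (n₀ + C + c + 1) := Nat.lt_two_pow_self
  omega

/-- R106 (shadow form): the five print laws exclude the `μ ≥ 1` signature of the crossed module. -/
theorem R106_shadow {B G n₀ : ℕ} (hA : WilesCountModTwo D) (hB : KummerIntoTower D)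
    (hC : TowerPrimeFG D B) (hD : DecompositionBounded D G n₀) (hE : InertiaControl D n₀) :
    ¬ MuPositiveSignature D.dY :=
  not_muPositive_of_bounded (crossed_dim_bounded D hA hB hC hD hE)

/-- Sanity instance `F = K₀ = ℚ(√−7)` (class number 1, units ±1): `X^{(𝔭̄)}(K₀) ≅ ℤ₂`,
`T^{𝔭̄}(K₀) = 1` (`−1 ∉ ℚ₂^{×2}`), `g_𝔭̄ = 1`, `X^{(𝔭)}(K₀) ≅ ℤ₂`: (A) reads `1 = 1 + 0`,
the reflection inequality reads `1 ≤ 1 + 1`. -/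
example : (1 : ℕ) = 1 + 0 ∧ (1 : ℕ) ≤ 1 + 1 := by decide

/-! ## §B′  The dual Selmer group `T^{P}(F)` as a Mathlib object

Mathlib's `IsDedekindDomain.selmerGroup` is `F(S, n) = {x ∈ Fˣ/n : v(x) ≡ 0 (mod n) ∀ v ∉ S}`; the
dual Selmer group of step (A) is `F(∅, 2)` cut by the local-square conditions at the primes of `P`
(`P` = the primes of `F` above `𝔭̄`).  The Kummer inclusion (B) sends `x ↦ F(√x)`. -/

section DualSelmer

open IsDedekindDomain

variable (R : Type*) [CommRing R] [IsDedekindDomain R] (F : Type*) [Field F] [Algebra R F]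
  [IsFractionRing R F]

/-- `T^{P}(F) ⊆ Fˣ/Fˣ²`: all valuations even, and locally a square at every `v ∈ P`
(well defined on classes: squares are local squares). For `R = 𝓞 F`, `F ⊇ K₀`, `P = {w ∣ 𝔭̄}` this
is `H¹_{L*}(F, μ₂)` of step (A). -/
def dualSelmerTwo (P : Set (HeightOneSpectrum R)) :
    Set (Fˣ ⧸ (powMonoidHom 2 : Fˣ →* Fˣ).range) :=
  {x | x ∈ selmerGroup (R := R) (K := F) (S := (∅ : Set (HeightOneSpectrum R))) (n := 2) ∧
    ∀ v ∈ P, ∀ u : Fˣ, (QuotientGroup.mk u : Fˣ ⧸ (powMonoidHom 2 : Fˣ →* Fˣ).range) = x →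
      IsSquare (algebraMap F (v.adicCompletion F) (u : F))}

/-- Shrinking `P` enlarges `T^{P}(F)` (fewer local conditions); `T^{∅}(F) = F(∅,2)`, of
`𝔽₂`-dimension `dim 𝓞_Fˣ/2 + dim Cl(F)[2] = r₂(F) + dim Cl(F)[2]` for totally complex `F`
(Mathlib: `selmerGroup.fromUnit`, `fromUnitLift_injective`). -/
theorem dualSelmerTwo_mono {P P' : Set (HeightOneSpectrum R)} (h : P ⊆ P') :
    dualSelmerTwo R F P' ⊆ dualSelmerTwo R F P := by
  intro x hx
  exact ⟨hx.1, fun v hv u hu => hx.2 v (h hv) u hu⟩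

end DualSelmer

/-! ## §C  R106's conclusion over the tree's Iwasawa algebra

`Λ = IwasawaAlgebra 2 = ℤ_[2]⟦T⟧`, `μ = Literature.NumberTheory.EllipticCurves.muInvariant 2`.
The two helpers below are the only sorried declarations of this file (declared helper stubs). -/

open Literature.NumberTheory.EllipticCurves

/-- HELPER H3 (compact Nakayama over `ℤ_p`, declared stub): a finitely generated `Λ`-module `M`
with `M/pM` finite is finitely generated over `ℤ_p` [Washington 1997, Lemma 13.16; NSW (5.2.18)].
(The bound `dim M/(p,ω_n)M ≤ C ∀n` of §B gives `#(M/pM) ≤ p^C` since `M/pM = lim M/(p,ω_n)M`.) -/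
theorem stub_fg_over_Zp_of_finite_mod_p (p : ℕ) [Fact p.Prime] (M : Type*) [AddCommGroup M]
    [Module (IwasawaAlgebra p) M] [Module.Finite (IwasawaAlgebra p) M]
    (hfin : Finite (M ⧸ (IwasawaAlgebra.augIdealP p • (⊤ : Submodule (IwasawaAlgebra p) M)))) :
    Module.Finite ℤ_[p] (RestrictScalars ℤ_[p] (IwasawaAlgebra p) M) := by
  sorry

/-- HELPER H4 (declared stub): a `Λ`-module finitely generated over `ℤ_p` is `Λ`-torsion
(`Λ` has infinite `ℤ_p`-rank; Washington §13.2). -/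
theorem stub_isTorsion_of_fg_over_Zp (p : ℕ) [Fact p.Prime] (M : Type*) [AddCommGroup M]
    [Module (IwasawaAlgebra p) M]
    (hfg : Module.Finite ℤ_[p] (RestrictScalars ℤ_[p] (IwasawaAlgebra p) M)) :
    Module.IsTorsion (IwasawaAlgebra p) M := by
  sorry

/-- **R106 typed**: for the crossed module `Y` (any f.g. `Λ`-module with `Y/2Y` finite — which is
what §B delivers), `μ(Y) = 0`, given the named folklore fact `muInvariant_eq_zero_iff`
(Washington §13.2) already declared in `Literature/NumberTheory/EllipticCurves/IwasawaAlgebra.lean`. -/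
theorem R106_mu_eq_zero (Y : Type*) [AddCommGroup Y] [Module (IwasawaAlgebra 2) Y]
    [Module.Finite (IwasawaAlgebra 2) Y]
    (hfact : muInvariant_eq_zero_iff 2 Y)
    (hfin : Finite (Y ⧸ (IwasawaAlgebra.augIdealP 2 • (⊤ : Submodule (IwasawaAlgebra 2) Y)))) :
    muInvariant 2 Y = 0 := by
  have hfg := stub_fg_over_Zp_of_finite_mod_p 2 Y hfin
  have htors := stub_isTorsion_of_fg_over_Zp 2 Y hfg
  exact (hfact htors).mpr hfg

/-! ## §D  What arm M″ of the stub consumes -/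

/-- STUB-PLAN §3(vii): `ε = 𝔽₂⟦T⟧-rank of Y[c−1]/(c+1)Y ≤ μ(Y)`; with R106, `ε = 0` on EVERY
member and anchor of the four families (class-uniform, not just at anchors). -/
theorem eps_eq_zero (ε μY : ℕ) (hle : ε ≤ μY) (hR106 : μY = 0) : ε = 0 := by omega

/-- The anchor identity of `StubPlanT3ArmMSecondV12.armM_v12_of_T1minus` with its `hε₀` slot
discharged: `2 n'₀ = m₀ − e + ρ + 2 σ₀`. -/
theorem anchor_T1_identity (n'₀ m₀ e ρ ε₀ σ₀ : ℤ)
    (hT1₀ : 2 * n'₀ = m₀ - e + ρ + 2 * ε₀ + 2 * σ₀) (hε₀ : ε₀ = 0) :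
    2 * n'₀ = m₀ - e + ρ + 2 * σ₀ := by
  subst hε₀; omega

/-- Corollary for the analytic fallback of R106: from `0 → U_{𝔭̄,∞}/Ē_∞ → Y → A_∞ → 0` and
`0 → Ē_∞/C̄_∞ → U_{𝔭̄,∞}/C̄_∞ → U_{𝔭̄,∞}/Ē_∞ → 0` (μ additive), R106 (`μ(Y) = 0`) gives
`μ(U_{𝔭̄,∞}/C̄_∞) = μ(Ē_∞/C̄_∞)`: the μ of the restricted two-variable measure `G|_ℓ` (Coleman
identifies `char U_{𝔭̄,∞}/C̄_∞` with it) equals the elliptic-unit-index μ along the tower. -/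
theorem mu_restricted_eq_unitIndex (μY μUE μA μEC μUC : ℕ)
    (hY : μY = μUE + μA) (hU : μUC = μEC + μUE) (hR106 : μY = 0) : μUC = μEC := by omega

end Summit.BirchSwinnertonDyer.BirchSwinnertonDyer.Cruxes.SplitBadTwoLowerHalfOfFacts.HeegnerIndexTwo.K2G17
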